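import Summits.QuantumFields.YangMills.Theorems.BalabanUVNodesSpineReadingOfRecord13CoPHKComponentSizeBlocksInside
import Literature.MathematicalPhysics.QuantumFieldTheory.Balaban1983to89.Node00.TwoRunSiteSkeletons

/-!
# THE PEIERLS ASSEMBLY ON SKELETONS — the component-size reading of the K-kit paid with ONE letter per SEPARATED block: a component of `≥ m·k·L^{4·lv}` finest sites at
# level `j` contains `k` pairwise `Nr`-separated `lv`-blocks connected for the skeleton adjacency (`Node00.SkelTouch SiteTouch Nr`), the separated skeleton animals number
# `≤ |Site_{lv}| · (m·3^d·m)^{2(k−1)}`, so SEPARATED block letters `η K j ^ k` give the N20 face; numerical half discharged: `k K j ≥ ⌈log₂|Site_{lv}|⌉ + K + j + 3`,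
# `2·(81·m²)²·η ≤ 1`, `η ≤ η₀ ≤ 1` ⇒ `W K ≤ η₀ · 2^{−(K+1)}`

Cell `pub-ymgap`, YM-PLAN Track A (HUMAN RULING D-0062; width push D-0149); seat `pub-ymgap-dag-n20-d` (R134 (a) N20 NE7b s3 = the U5d ∕ `crOfRecord₁₃` lineage, its declarer)
gen 34; companion of `…CoPHKComponentSizeBlocks` (gen 33: the block-grain assembly with TOUCHING animals, `levelTerm_le_of_schedule`), `…CoPHKComponentSizeLevels` (p704298:
`relWeightBound_bigComponent_of_levelLetters`), `…CoPHKComponentSizePeierls` (p710912: `sum_le_sum_sum_of_finite_cover`, `exists_eq_mk_of_mem_classSetK₁₃`),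
`Node00/TwoRunSiteBlockAnimals` (gen 33: `hasBigComponent_image_iterBlockOf`) and `Node00/TwoRunSiteSkeletons` (gen 34: `sepAnimalCoverFamily`,
`exists_mem_sepAnimalCoverFamily_siteTouch_of_hasBigComponent`, `card_sepAnimalCoverFamily_siteTouch_le`).  `--kind proof --supports stmt-QuantumFields-27366 --as helper` (K3⁸);
COUNT-NEUTRAL; THEOREMS ONLY (0 `def`).  [LF-II] = [Balaban1989LargeFieldII]; [III] = [Balaban1988Convergent].
WHY (located defect of the gen-33 currency, numbers not adjectives).  Gen 33 pays ONE factor `δ ≤ 1∕12800` per block of a TOUCHING animal inside `Z_j`.  Bałaban's regions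
carry the layer calculus ([LF-II] (1.76) p. 381 `Z ⊂ ⋃(Zᵢ⁰)^{∼2}`; p. 384 `S(Z) = Z′^{∼10}`): the enlargement of ONE genuine large-field cube puts `(2ϱ+1)^4` blocks into `Z_j` at
once, so the per-touching-block letter can only be inhabited as `δ = θ^{1∕(4ϱ+1)^4}` from a per-SEPARATED-block factor `θ` — with `δ ≤ 1∕12800` that asks `θ ≤ 12800^{−(4ϱ+1)^4}`.
Print pays per DOMAIN of a tree graph of touching domains ((1.84)–(1.88) pp. 386–387), never per cube of a layer.  REPAIR (this file, over `Node00/TwoRunSiteSkeletons`): run the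
Peierls argument on SKELETONS.  For a supplier-chosen reflexive symmetric closeness `Nr K j` on the level-`lv K j` blocks (e.g. sup-distance `≤ 2ϱ`) of covering number
`m K j`: a `SiteTouch`-component of `≥ m·k` blocks contains `k` pairwise `Nr`-SEPARATED blocks forming a `SkelTouch`-connected set; these separated skeleton `k`-animals number
`≤ |Site_{lv}| · (m·3^4·m)^{2(k−1)}` (entropy polynomial in `m`), and the energy letter is asked ONLY for separated block sets: `η K j ^ k` with `2·(81·m²)²·η ≤ 1` — i.e.
`θ = η ≲ 10^{−4}·m^{−4}`, POLYNOMIAL in the enlargement radius instead of `12800^{−(4ϱ+1)^4}`.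
WHAT IS HERE.  §1 [folklore] the schedule arithmetic of gen 33 with a GENERAL entropy base (`levelTerm_le_of_schedule_base`, `levelSum_le_of_schedule_base`); §2 ★ `bad_level_subset_skelCover`
∕ ★ `sum_bad_level_le_sum_skelCover` (the cover and union bound at block grain over the separated skeleton family; dial `bigDialOfCard₁₃ K₀ (fun K j ↦ m K j * k K j * (F.L^4)^(lv K j))`,
component thresholds `m·k·L^{4·lv}` finest sites); §3 ★★ `levelLetter_of_sepBlockLetters_left ∕ _right`, ★★★ `relWeightBound_card_of_sepBlockLetters` (separated block letters in both
runs + level sums `< 1`, summable ⇒ `RelWeightBound` at the coarse carriers) and ★★★ `relWeightBound_card_of_sepBlockLetters_geometric` (the numerical half DISCHARGED under the schedule: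
`W K := η₀ · 2^{−(K+1)}`).  The companion `…BlocksSkeletonCond` (gen 34) derives the separated letters from ONE-BLOCK CONDITIONAL letters (chain rule) and gives the INSIDE editions.
HONEST FRAMING.  [folklore] finite-sum bookkeeping + torus block ∕ skeleton geometry BY NAME + elementary real arithmetic; the separated block energy letters `η K j` are HYPOTHESES
(inhabited for no family today; NOT PRINTED as statements about the (2.18) class weights; LCS-shaped — the RELATIVE weight of «`Z_j` meets every block of a separated set»);
`Nr`, `m`, `k`, `lv` are the supplier's dials (fitness for node U5's matching is the plan's call, not claimed); NO weight is bounded here, NO estimate proved; nothing of Bałaban's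
asserted; NE7 ∕ NE7b ∕ NE7c NOT PRINTED for `d = 4` ∕ NOT proved; no `Provisos₁₃CoPH` inhabitant claimed (K0⁷ OPEN); K3⁸ v7 untouched; N19 ∕ N20 ∕ N21 ∕ N27 NOT discharged; counts
UNMOVED (typed 28∕28 · discharged 8∕27); one finite four-torus programme at fixed `ε` — NOT ℝ⁴, NOT OS, NOT a mass gap, NOT the Clay problem.  No `def`, no `instance`, no
`notation`, no `sorry`; no decl below carries a cite tag.
-/

noncomputable section

open scoped BigOperators
open Finset

namespace YMDAG.UVSplit

open Literature.MathematicalPhysics.QuantumFieldTheory.Balaban1983to89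
open Literature.MathematicalPhysics.QuantumFieldTheory.Balaban1983to89.T4Continuum
open Literature.MathematicalPhysics.QuantumFieldTheory.Balaban1983to89.Node00
open Literature.MathematicalPhysics.QuantumFieldTheory.Balaban1983to89.B5Eq118OneStroke (iterBlockOf iterBlock)
open T4WeightBudget (RelWeightBound)
open Summit.QuantumFields.YangMills.BalabanUVNodes.N21KeyedShellWeightShellZero (weightA₁₃_nonneg weightB₁₃_nonneg)
open Summit.QuantumFields.YangMills.BalabanUVNodes.N20KeyedRelWeightAtKeyReading (fst_eq_of_mem_classSetK₁₃)

variable {F : T4Family} {N : ℕ} [NeZero N]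

/-! ## §1 [folklore] The schedule arithmetic with a general entropy base -/

section Schedule

/-- [folklore] **ONE LEVEL TERM UNDER THE SCHEDULE, GENERAL ENTROPY BASE `E ≥ 0`**: with `V = |Site_{lv}|`, thresholds `k ≥ ⌈log₂ V⌉ + K + j + 3`, a letter `0 ≤ η ≤ η₀` with
`2·E²·η ≤ 1`, the entropy-weighted term is at most `η₀ · 2^{−(K+j+2)}`: `V · E^{2(k−1)} · η^k = V · (E² η)^{k−1} · η ≤ V · 2^{−(k−1)} · η₀ ≤ η₀ · 2^{−(K+j+2)}`.  (Gen 33's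
`levelTerm_le_of_schedule` is the case `E = 3^4 − 1` with the smallness put on `η₀`.) [bookkeeping] -/
theorem levelTerm_le_of_schedule_base {V k K j : ℕ} {E η η₀ : ℝ} (hk : Nat.clog 2 V + K + j + 3 ≤ k) (hE : 0 ≤ E) (hη0 : 0 ≤ η) (hη1 : η ≤ η₀)
    (hD : 2 * E ^ 2 * η ≤ 1) :
    (V : ℝ) * E ^ (2 * (k - 1)) * η ^ k ≤ η₀ * (1 / 2) ^ (K + j + 2) := by
  have hη₀ : 0 ≤ η₀ := hη0.trans hη1
  have hk1 : 1 ≤ k := by omega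
  have hterm : (V : ℝ) * E ^ (2 * (k - 1)) * η ^ k = (V : ℝ) * ((E ^ 2 * η) ^ (k - 1) * η) := by
    have hpow : η ^ k = η ^ (k - 1) * η := by
      rw [← pow_succ, Nat.sub_add_cancel hk1]
    rw [hpow, mul_pow, ← pow_mul, mul_comm 2 (k - 1)]
    ring
  have hhalf : E ^ 2 * η ≤ 1 / 2 := by linarith
  have hge : (0 : ℝ) ≤ E ^ 2 * η := mul_nonneg (pow_nonneg hE 2) hη0
  have hpowle : (E ^ 2 * η) ^ (k - 1) ≤ (1 / 2 : ℝ) ^ (k - 1) := pow_le_pow_left₀ hge hhalf _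
  have hVle : (V : ℝ) ≤ (2 : ℝ) ^ Nat.clog 2 V := by exact_mod_cast Nat.le_pow_clog (by norm_num : 1 < 2) V
  have hexp : Nat.clog 2 V + (K + j + 2) ≤ k - 1 := by omega
  have hVhalf : (V : ℝ) * (1 / 2 : ℝ) ^ (k - 1) ≤ (1 / 2 : ℝ) ^ (K + j + 2) := by
    have h2 : (1 / 2 : ℝ) ^ (k - 1) ≤ (1 / 2 : ℝ) ^ (Nat.clog 2 V + (K + j + 2)) :=
      pow_le_pow_of_le_one (by norm_num) (by norm_num) hexp
    calc (V : ℝ) * (1 / 2 : ℝ) ^ (k - 1) ≤ (2 : ℝ) ^ Nat.clog 2 V * (1 / 2 : ℝ) ^ (Nat.clog 2 V + (K + j + 2)) :=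
          mul_le_mul hVle h2 (pow_nonneg (by norm_num) _) (pow_nonneg (by norm_num) _)
      _ = (1 / 2 : ℝ) ^ (K + j + 2) := by
          rw [pow_add, ← mul_assoc, ← mul_pow]
          norm_num
  calc (V : ℝ) * E ^ (2 * (k - 1)) * η ^ k = (V : ℝ) * ((E ^ 2 * η) ^ (k - 1) * η) := hterm
    _ ≤ (V : ℝ) * ((1 / 2 : ℝ) ^ (k - 1) * η₀) :=
        mul_le_mul_of_nonneg_left (mul_le_mul hpowle hη1 hη0 (pow_nonneg (by norm_num) _)) (Nat.cast_nonneg V)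
    _ = (V : ℝ) * (1 / 2 : ℝ) ^ (k - 1) * η₀ := by ring
    _ ≤ (1 / 2 : ℝ) ^ (K + j + 2) * η₀ := mul_le_mul_of_nonneg_right hVhalf hη₀
    _ = η₀ * (1 / 2) ^ (K + j + 2) := mul_comm _ _

/-- [folklore] **THE LEVEL SUM UNDER THE SCHEDULE, GENERAL ENTROPY BASES `E K j ≥ 0`**, is at most `η₀ · 2^{−(K+1)}`. [bookkeeping] -/
theorem levelSum_le_of_schedule_base (jcut : ℕ → ℕ) (V k : ℕ → ℕ → ℕ) (E η : ℕ → ℕ → ℝ) {η₀ : ℝ} (hE : ∀ K j, 0 ≤ E K j) (hη0 : ∀ K j, 0 ≤ η K j)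
    (hη1 : ∀ K j, η K j ≤ η₀) (hD : ∀ K j, 2 * E K j ^ 2 * η K j ≤ 1) (hk : ∀ K j, Nat.clog 2 (V K j) + K + j + 3 ≤ k K j) (K : ℕ) :
    ∑ j ∈ Finset.Icc 1 (jcut K), (V K j : ℝ) * E K j ^ (2 * (k K j - 1)) * η K j ^ k K j ≤ η₀ * (1 / 2) ^ (K + 1) := by
  have hη₀ : 0 ≤ η₀ := (hη0 0 0).trans (hη1 0 0)
  have hterm : ∀ j ∈ Finset.Icc 1 (jcut K), (V K j : ℝ) * E K j ^ (2 * (k K j - 1)) * η K j ^ k K j ≤ η₀ * (1 / 2) ^ (K + j + 2) :=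
    fun j _ => levelTerm_le_of_schedule_base (hk K j) (hE K j) (hη0 K j) (hη1 K j) (hD K j)
  have hgeom : ∑ j ∈ Finset.Icc 1 (jcut K), (1 / 2 : ℝ) ^ j ≤ 2 :=
    (Finset.sum_le_sum_of_subset_of_nonneg (by
        intro j hj
        rw [Finset.mem_Icc] at hj
        exact Finset.mem_range.2 (by omega)) (fun j _ _ => pow_nonneg (by norm_num) j)).trans (sum_geometric_two_le (jcut K + 1))
  calc ∑ j ∈ Finset.Icc 1 (jcut K), (V K j : ℝ) * E K j ^ (2 * (k K j - 1)) * η K j ^ k K j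
      ≤ ∑ j ∈ Finset.Icc 1 (jcut K), η₀ * (1 / 2) ^ (K + j + 2) := Finset.sum_le_sum hterm
    _ = η₀ * (1 / 2) ^ (K + 2) * ∑ j ∈ Finset.Icc 1 (jcut K), (1 / 2 : ℝ) ^ j := by
        rw [Finset.mul_sum]
        refine Finset.sum_congr rfl fun j _ => ?_
        rw [show K + j + 2 = K + 2 + j by omega, pow_add]
        ring
    _ ≤ η₀ * (1 / 2) ^ (K + 2) * 2 := mul_le_mul_of_nonneg_left hgeom (mul_nonneg hη₀ (pow_nonneg (by norm_num) _))
    _ = η₀ * (1 / 2) ^ (K + 1) := by rw [pow_succ]; ring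

end Schedule

/-! ## §2 The skeleton cover at class level and the union bound, at block grain -/

section Cover

variable (θ : Stage13HParams F N) (hP : θ.Provisos₁₃CoPH F N) (K₀ : ℕ) (g₀ : ℕ → ℝ) (os : List (ULoop F))
  (kr : ℕ → (Σ K, SiteSeqKey F (K₀ + K)) → (Σ K, SiteSeqKey F (K₀ + K))) (m k lv : ℕ → ℕ → ℕ)
  (Nr : (K j : ℕ) → Site (F.P (K₀ + K)) (lv K j) → Site (F.P (K₀ + K)) (lv K j) → Prop)

/-- ★ **A CLASS WITH A COMPONENT OF `≥ m K j · k K j · L^{4·lv K j}` FINEST SITES AT LEVEL `j` LIES IN THE EVENT CLASS OF SOME SEPARATED SKELETON ANIMAL** (step-preserving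
dial, `1 ≤ k K j`, block level `lv K j ≤ m + K₀ + K`, `Nr K j` reflexive symmetric of covering number `m K j`): the block image of the region has a `SiteTouch`-component of
`≥ m·k` blocks (`Node00.hasBigComponent_image_iterBlockOf`), hence contains the separated `SkelTouch`-connected `k`-set of some member `p = (y₀, A)` of
`Node00.sepAnimalCoverFamily SiteTouch (Nr K j) (k K j)`; the event of the member is «`↑A ⊆ iterBlockOf (lv K j) '' (y.2 j)ᶜ`» (every block of `A` MEETS `Z_j`). [bookkeeping] -/
theorem bad_level_subset_skelCover (hkr : ∀ (K : ℕ) (x : Σ K, SiteSeqKey F (K₀ + K)), x ∈ classSet₁₃ θ K₀ g₀ K → (kr K x).1 = K) (K : ℕ) (t : ℝ) {j : ℕ}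
    (hlv : lv K j ≤ F.m + (K₀ + K)) (hk : 1 ≤ k K j) (hrefl : ∀ a, Nr K j a a) (hsymm : ∀ a b, Nr K j a b → Nr K j b a)
    (hm : ∀ b, ∃ s : Finset (Site (F.P (K₀ + K)) (lv K j)), s.card ≤ m K j ∧ ∀ c, Nr K j c b → c ∈ s) {u : Σ K, SiteSeqKey F (K₀ + K)}
    (hu : u ∈ badClassK₁₃ θ K₀ g₀ kr
      (fun _ u => HasBigComponent SiteTouch (bigDialOfCard₁₃ (N := N) K₀ (fun K j => m K j * k K j * (F.L ^ 4) ^ lv K j) F θ hP g₀ os u.1 j) (u.2.2 j)ᶜ) K t) :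
    ∃ p ∈ sepAnimalCoverFamily (SiteTouch (P := F.P (K₀ + K)) (j := lv K j)) (Nr K j) (k K j),
      u ∈ badClassK₁₃ θ K₀ g₀ kr (fun _ u => ∀ y : SiteSeqKey F (K₀ + K), u = ⟨K, y⟩ →
        (↑p.2 : Set (Site (F.P (K₀ + K)) (lv K j))) ⊆ iterBlockOf (lv K j) '' (y.2 j)ᶜ) K t := by
  obtain ⟨huS, hbig⟩ := (mem_badClassK₁₃_iff θ K₀ g₀ kr _ K t u).1 hu
  obtain ⟨y, rfl⟩ := exists_eq_mk_of_mem_classSetK₁₃ θ K₀ g₀ kr hkr K huS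
  have hblock := hasBigComponent_image_iterBlockOf (P := F.P (K₀ + K)) (ℓ := lv K j)
    (m := fun j => m K j * k K j * (F.L ^ 4) ^ lv K j) (lvl := j) (n := m K j * k K j) hlv le_rfl hbig
  obtain ⟨p, hp, hpZ⟩ := exists_mem_sepAnimalCoverFamily_siteTouch_of_hasBigComponent (Nr K j) hrefl hsymm hm hk
    (thr := fun _ => m K j * k K j) (lvl := j) le_rfl hblock
  refine ⟨p, hp, (mem_badClassK₁₃_iff θ K₀ g₀ kr _ K t _).2 ⟨huS, ?_⟩⟩
  intro y' hy'
  have hyy' : y = y' := eq_of_heq (Sigma.mk.inj hy').2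
  rw [← hyy']
  exact hpZ

/-- ★ **THE UNION BOUND OVER THE SEPARATED SKELETON FAMILY** (step-preserving dial, non-negative summand on the coarse class set). [bookkeeping] -/
theorem sum_bad_level_le_sum_skelCover (hkr : ∀ (K : ℕ) (x : Σ K, SiteSeqKey F (K₀ + K)), x ∈ classSet₁₃ θ K₀ g₀ K → (kr K x).1 = K) (K : ℕ) (t : ℝ) {j : ℕ}
    (hlv : lv K j ≤ F.m + (K₀ + K)) (hk : 1 ≤ k K j) (hrefl : ∀ a, Nr K j a a) (hsymm : ∀ a b, Nr K j a b → Nr K j b a)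
    (hm : ∀ b, ∃ s : Finset (Site (F.P (K₀ + K)) (lv K j)), s.card ≤ m K j ∧ ∀ c, Nr K j c b → c ∈ s)
    (f : (Σ K, SiteSeqKey F (K₀ + K)) → ℝ) (hf : ∀ u ∈ classSetK₁₃ θ K₀ g₀ kr K, 0 ≤ f u) :
    ∑ u ∈ badClassK₁₃ θ K₀ g₀ kr
        (fun _ u => HasBigComponent SiteTouch (bigDialOfCard₁₃ (N := N) K₀ (fun K j => m K j * k K j * (F.L ^ 4) ^ lv K j) F θ hP g₀ os u.1 j) (u.2.2 j)ᶜ) K t, f u ≤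
      ∑ p ∈ sepAnimalCoverFamily (SiteTouch (P := F.P (K₀ + K)) (j := lv K j)) (Nr K j) (k K j),
        ∑ u ∈ badClassK₁₃ θ K₀ g₀ kr (fun _ u => ∀ y : SiteSeqKey F (K₀ + K), u = ⟨K, y⟩ →
          (↑p.2 : Set (Site (F.P (K₀ + K)) (lv K j))) ⊆ iterBlockOf (lv K j) '' (y.2 j)ᶜ) K t, f u := by
  classical
  exact sum_le_sum_sum_of_finite_cover (classSetK₁₃ θ K₀ g₀ kr K) _ _ _ f (badClassK₁₃_subset θ K₀ g₀ kr _ K t)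
    (fun p _ => badClassK₁₃_subset θ K₀ g₀ kr _ K t) hf (fun u hu => bad_level_subset_skelCover θ hP K₀ g₀ os kr m k lv Nr hkr K t hlv hk hrefl hsymm hm hu)

end Cover

/-! ## §3 The level letter from SEPARATED block letters; the face -/

section Assembly

variable (θ : Stage13HParams F N) (hP : θ.Provisos₁₃CoPH F N) (K₀ : ℕ) (g₀ : ℕ → ℝ) (os : List (ULoop F))
  (kr : ℕ → (Σ K, SiteSeqKey F (K₀ + K)) → (Σ K, SiteSeqKey F (K₀ + K))) (jcut : ℕ → ℕ) (m k lv : ℕ → ℕ → ℕ)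
  (Nr : (K j : ℕ) → Site (F.P (K₀ + K)) (lv K j) → Site (F.P (K₀ + K)) (lv K j) → Prop)

/-- ★★ **RUN A's LEVEL LETTER FROM SEPARATED BLOCK LETTERS**: if for every member `(y₀, A)` of the separated skeleton family the coarse classes whose level-`j` region meets
every block of `A` weigh at most `η K j ^ (k K j)` of run A's total (`0 ≤ η`), then the classes with a component of `≥ m·k·L^{4·lv}` finest sites at level `j` weigh at most
`|Site_{lv K j}| · (m·3^d·m)^{2(k K j − 1)} · η K j ^ (k K j)` of it. [bookkeeping] -/
theorem levelLetter_of_sepBlockLetters_left (hkr : ∀ (K : ℕ) (x : Σ K, SiteSeqKey F (K₀ + K)), x ∈ classSet₁₃ θ K₀ g₀ K → (kr K x).1 = K)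
    {η : ℕ → ℕ → ℝ} (hη : ∀ K j, 0 ≤ η K j) (K : ℕ) {t : ℝ} {j : ℕ} (hlv : lv K j ≤ F.m + (K₀ + K)) (hk : 1 ≤ k K j)
    (hrefl : ∀ a, Nr K j a a) (hsymm : ∀ a b, Nr K j a b → Nr K j b a)
    (hm : ∀ b, ∃ s : Finset (Site (F.P (K₀ + K)) (lv K j)), s.card ≤ m K j ∧ ∀ c, Nr K j c b → c ∈ s)
    (hE : ∀ p ∈ sepAnimalCoverFamily (SiteTouch (P := F.P (K₀ + K)) (j := lv K j)) (Nr K j) (k K j),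
      ∑ u ∈ badClassK₁₃ θ K₀ g₀ kr (fun _ u => ∀ y : SiteSeqKey F (K₀ + K), u = ⟨K, y⟩ →
          (↑p.2 : Set (Site (F.P (K₀ + K)) (lv K j))) ⊆ iterBlockOf (lv K j) '' (y.2 j)ᶜ) K t,
          weightAK₁₃ θ hP K₀ g₀ os kr K t u ≤ η K j ^ k K j * ∑ u ∈ classSetK₁₃ θ K₀ g₀ kr K, weightAK₁₃ θ hP K₀ g₀ os kr K t u) :
    ∑ u ∈ badClassK₁₃ θ K₀ g₀ kr
        (fun _ u => HasBigComponent SiteTouch (bigDialOfCard₁₃ (N := N) K₀ (fun K j => m K j * k K j * (F.L ^ 4) ^ lv K j) F θ hP g₀ os u.1 j) (u.2.2 j)ᶜ) K t,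
        weightAK₁₃ θ hP K₀ g₀ os kr K t u ≤
      (Fintype.card (Site (F.P (K₀ + K)) (lv K j)) * ((m K j : ℝ) * 3 ^ (F.P (K₀ + K)).d * m K j) ^ (2 * (k K j - 1)) * η K j ^ k K j) *
        ∑ u ∈ classSetK₁₃ θ K₀ g₀ kr K, weightAK₁₃ θ hP K₀ g₀ os kr K t u := by
  classical
  have htot : 0 ≤ ∑ u ∈ classSetK₁₃ θ K₀ g₀ kr K, weightAK₁₃ θ hP K₀ g₀ os kr K t u :=
    Finset.sum_nonneg fun u _ => weightAK₁₃_nonneg θ hP K₀ g₀ os kr (fun x _ => weightA₁₃_nonneg F θ hP K₀ g₀ os K t x) u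
  have hcard : ((sepAnimalCoverFamily (SiteTouch (P := F.P (K₀ + K)) (j := lv K j)) (Nr K j) (k K j)).card : ℝ) ≤
      Fintype.card (Site (F.P (K₀ + K)) (lv K j)) * ((m K j : ℝ) * 3 ^ (F.P (K₀ + K)).d * m K j) ^ (2 * (k K j - 1)) := by
    have h := card_sepAnimalCoverFamily_siteTouch_le (P := F.P (K₀ + K)) (j := lv K j) (Nr K j) hsymm hm (k K j)
    calc ((sepAnimalCoverFamily (SiteTouch (P := F.P (K₀ + K)) (j := lv K j)) (Nr K j) (k K j)).card : ℝ)
        ≤ ((Fintype.card (Site (F.P (K₀ + K)) (lv K j)) * (m K j * 3 ^ (F.P (K₀ + K)).d * m K j) ^ (2 * (k K j - 1)) : ℕ) : ℝ) := by exact_mod_cast h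
      _ = Fintype.card (Site (F.P (K₀ + K)) (lv K j)) * ((m K j : ℝ) * 3 ^ (F.P (K₀ + K)).d * m K j) ^ (2 * (k K j - 1)) := by push_cast; ring
  calc ∑ u ∈ badClassK₁₃ θ K₀ g₀ kr
          (fun _ u => HasBigComponent SiteTouch (bigDialOfCard₁₃ (N := N) K₀ (fun K j => m K j * k K j * (F.L ^ 4) ^ lv K j) F θ hP g₀ os u.1 j) (u.2.2 j)ᶜ) K t,
          weightAK₁₃ θ hP K₀ g₀ os kr K t u
      ≤ ∑ p ∈ sepAnimalCoverFamily (SiteTouch (P := F.P (K₀ + K)) (j := lv K j)) (Nr K j) (k K j),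
          ∑ u ∈ badClassK₁₃ θ K₀ g₀ kr (fun _ u => ∀ y : SiteSeqKey F (K₀ + K), u = ⟨K, y⟩ →
              (↑p.2 : Set (Site (F.P (K₀ + K)) (lv K j))) ⊆ iterBlockOf (lv K j) '' (y.2 j)ᶜ) K t,
            weightAK₁₃ θ hP K₀ g₀ os kr K t u :=
        sum_bad_level_le_sum_skelCover θ hP K₀ g₀ os kr m k lv Nr hkr K t hlv hk hrefl hsymm hm _
          (fun u _ => weightAK₁₃_nonneg θ hP K₀ g₀ os kr (fun x _ => weightA₁₃_nonneg F θ hP K₀ g₀ os K t x) u)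
    _ ≤ ∑ _p ∈ sepAnimalCoverFamily (SiteTouch (P := F.P (K₀ + K)) (j := lv K j)) (Nr K j) (k K j),
          η K j ^ k K j * ∑ u ∈ classSetK₁₃ θ K₀ g₀ kr K, weightAK₁₃ θ hP K₀ g₀ os kr K t u := Finset.sum_le_sum hE
    _ = (sepAnimalCoverFamily (SiteTouch (P := F.P (K₀ + K)) (j := lv K j)) (Nr K j) (k K j)).card *
          (η K j ^ k K j * ∑ u ∈ classSetK₁₃ θ K₀ g₀ kr K, weightAK₁₃ θ hP K₀ g₀ os kr K t u) := by rw [Finset.sum_const, nsmul_eq_mul]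
    _ ≤ (Fintype.card (Site (F.P (K₀ + K)) (lv K j)) * ((m K j : ℝ) * 3 ^ (F.P (K₀ + K)).d * m K j) ^ (2 * (k K j - 1))) *
          (η K j ^ k K j * ∑ u ∈ classSetK₁₃ θ K₀ g₀ kr K, weightAK₁₃ θ hP K₀ g₀ os kr K t u) :=
        mul_le_mul_of_nonneg_right hcard (mul_nonneg (pow_nonneg (hη K j) _) htot)
    _ = _ := by ring

/-- ★★ **RUN B's LEVEL LETTER FROM SEPARATED BLOCK LETTERS**, likewise. [bookkeeping] -/
theorem levelLetter_of_sepBlockLetters_right (hkr : ∀ (K : ℕ) (x : Σ K, SiteSeqKey F (K₀ + K)), x ∈ classSet₁₃ θ K₀ g₀ K → (kr K x).1 = K)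
    {η : ℕ → ℕ → ℝ} (hη : ∀ K j, 0 ≤ η K j) (K : ℕ) {t : ℝ} {j : ℕ} (hlv : lv K j ≤ F.m + (K₀ + K)) (hk : 1 ≤ k K j)
    (hrefl : ∀ a, Nr K j a a) (hsymm : ∀ a b, Nr K j a b → Nr K j b a)
    (hm : ∀ b, ∃ s : Finset (Site (F.P (K₀ + K)) (lv K j)), s.card ≤ m K j ∧ ∀ c, Nr K j c b → c ∈ s)
    (hE : ∀ p ∈ sepAnimalCoverFamily (SiteTouch (P := F.P (K₀ + K)) (j := lv K j)) (Nr K j) (k K j),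
      ∑ u ∈ badClassK₁₃ θ K₀ g₀ kr (fun _ u => ∀ y : SiteSeqKey F (K₀ + K), u = ⟨K, y⟩ →
          (↑p.2 : Set (Site (F.P (K₀ + K)) (lv K j))) ⊆ iterBlockOf (lv K j) '' (y.2 j)ᶜ) K t,
          weightBK₁₃ θ hP K₀ g₀ os kr K t u ≤ η K j ^ k K j * ∑ u ∈ classSetK₁₃ θ K₀ g₀ kr K, weightBK₁₃ θ hP K₀ g₀ os kr K t u) :
    ∑ u ∈ badClassK₁₃ θ K₀ g₀ kr
        (fun _ u => HasBigComponent SiteTouch (bigDialOfCard₁₃ (N := N) K₀ (fun K j => m K j * k K j * (F.L ^ 4) ^ lv K j) F θ hP g₀ os u.1 j) (u.2.2 j)ᶜ) K t,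
        weightBK₁₃ θ hP K₀ g₀ os kr K t u ≤
      (Fintype.card (Site (F.P (K₀ + K)) (lv K j)) * ((m K j : ℝ) * 3 ^ (F.P (K₀ + K)).d * m K j) ^ (2 * (k K j - 1)) * η K j ^ k K j) *
        ∑ u ∈ classSetK₁₃ θ K₀ g₀ kr K, weightBK₁₃ θ hP K₀ g₀ os kr K t u := by
  classical
  have htot : 0 ≤ ∑ u ∈ classSetK₁₃ θ K₀ g₀ kr K, weightBK₁₃ θ hP K₀ g₀ os kr K t u :=
    Finset.sum_nonneg fun u _ => weightBK₁₃_nonneg θ hP K₀ g₀ os kr (fun x _ => weightB₁₃_nonneg F θ hP K₀ g₀ os K t x) u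
  have hcard : ((sepAnimalCoverFamily (SiteTouch (P := F.P (K₀ + K)) (j := lv K j)) (Nr K j) (k K j)).card : ℝ) ≤
      Fintype.card (Site (F.P (K₀ + K)) (lv K j)) * ((m K j : ℝ) * 3 ^ (F.P (K₀ + K)).d * m K j) ^ (2 * (k K j - 1)) := by
    have h := card_sepAnimalCoverFamily_siteTouch_le (P := F.P (K₀ + K)) (j := lv K j) (Nr K j) hsymm hm (k K j)
    calc ((sepAnimalCoverFamily (SiteTouch (P := F.P (K₀ + K)) (j := lv K j)) (Nr K j) (k K j)).card : ℝ)
        ≤ ((Fintype.card (Site (F.P (K₀ + K)) (lv K j)) * (m K j * 3 ^ (F.P (K₀ + K)).d * m K j) ^ (2 * (k K j - 1)) : ℕ) : ℝ) := by exact_mod_cast h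
      _ = Fintype.card (Site (F.P (K₀ + K)) (lv K j)) * ((m K j : ℝ) * 3 ^ (F.P (K₀ + K)).d * m K j) ^ (2 * (k K j - 1)) := by push_cast; ring
  calc ∑ u ∈ badClassK₁₃ θ K₀ g₀ kr
          (fun _ u => HasBigComponent SiteTouch (bigDialOfCard₁₃ (N := N) K₀ (fun K j => m K j * k K j * (F.L ^ 4) ^ lv K j) F θ hP g₀ os u.1 j) (u.2.2 j)ᶜ) K t,
          weightBK₁₃ θ hP K₀ g₀ os kr K t u
      ≤ ∑ p ∈ sepAnimalCoverFamily (SiteTouch (P := F.P (K₀ + K)) (j := lv K j)) (Nr K j) (k K j),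
          ∑ u ∈ badClassK₁₃ θ K₀ g₀ kr (fun _ u => ∀ y : SiteSeqKey F (K₀ + K), u = ⟨K, y⟩ →
              (↑p.2 : Set (Site (F.P (K₀ + K)) (lv K j))) ⊆ iterBlockOf (lv K j) '' (y.2 j)ᶜ) K t,
            weightBK₁₃ θ hP K₀ g₀ os kr K t u :=
        sum_bad_level_le_sum_skelCover θ hP K₀ g₀ os kr m k lv Nr hkr K t hlv hk hrefl hsymm hm _
          (fun u _ => weightBK₁₃_nonneg θ hP K₀ g₀ os kr (fun x _ => weightB₁₃_nonneg F θ hP K₀ g₀ os K t x) u)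
    _ ≤ ∑ _p ∈ sepAnimalCoverFamily (SiteTouch (P := F.P (K₀ + K)) (j := lv K j)) (Nr K j) (k K j),
          η K j ^ k K j * ∑ u ∈ classSetK₁₃ θ K₀ g₀ kr K, weightBK₁₃ θ hP K₀ g₀ os kr K t u := Finset.sum_le_sum hE
    _ = (sepAnimalCoverFamily (SiteTouch (P := F.P (K₀ + K)) (j := lv K j)) (Nr K j) (k K j)).card *
          (η K j ^ k K j * ∑ u ∈ classSetK₁₃ θ K₀ g₀ kr K, weightBK₁₃ θ hP K₀ g₀ os kr K t u) := by rw [Finset.sum_const, nsmul_eq_mul]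
    _ ≤ (Fintype.card (Site (F.P (K₀ + K)) (lv K j)) * ((m K j : ℝ) * 3 ^ (F.P (K₀ + K)).d * m K j) ^ (2 * (k K j - 1))) *
          (η K j ^ k K j * ∑ u ∈ classSetK₁₃ θ K₀ g₀ kr K, weightBK₁₃ θ hP K₀ g₀ os kr K t u) :=
        mul_le_mul_of_nonneg_right hcard (mul_nonneg (pow_nonneg (hη K j) _) htot)
    _ = _ := by ring

/-- ★★★ **THE N20 FACE AT THE SKELETON DIAL FROM SEPARATED BLOCK LETTERS** (step-preserving dial; `k K j ≥ 1`; block levels `lv K j ≤ m + K₀ + K`; `Nr K j` reflexive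
symmetric of covering number `m K j`): separated block letters `η K j ≥ 0` per member of the separated skeleton family in both runs, with the entropy-weighted level sums
`Σ_{j ≤ jcut K} |Site_{lv K j}| · (m·3^d·m)^{2(k K j − 1)} · η K j ^ (k K j)` below `1` and summable in `K`, give `RelWeightBound` at the coarse carriers with the bad class of
`badKeyReadingOfBigComponent₁₃ N K₀ jcut (bigDialOfCard₁₃ K₀ (m · k · L^{4·lv}))`. [bookkeeping] -/
theorem relWeightBound_card_of_sepBlockLetters (hkr : ∀ (K : ℕ) (x : Σ K, SiteSeqKey F (K₀ + K)), x ∈ classSet₁₃ θ K₀ g₀ K → (kr K x).1 = K)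
    {η : ℕ → ℕ → ℝ} (hη : ∀ K j, 0 ≤ η K j) (hk : ∀ K j, 1 ≤ k K j) (hlv : ∀ K j, lv K j ≤ F.m + (K₀ + K))
    (hrefl : ∀ K j a, Nr K j a a) (hsymm : ∀ K j a b, Nr K j a b → Nr K j b a)
    (hm : ∀ K j b, ∃ s : Finset (Site (F.P (K₀ + K)) (lv K j)), s.card ≤ m K j ∧ ∀ c, Nr K j c b → c ∈ s)
    (hEA : ∀ (K : ℕ) (t : ℝ), |t| ≤ 1 → ∀ j ∈ Finset.Icc 1 (jcut K), ∀ p ∈ sepAnimalCoverFamily (SiteTouch (P := F.P (K₀ + K)) (j := lv K j)) (Nr K j) (k K j),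
      ∑ u ∈ badClassK₁₃ θ K₀ g₀ kr (fun _ u => ∀ y : SiteSeqKey F (K₀ + K), u = ⟨K, y⟩ →
          (↑p.2 : Set (Site (F.P (K₀ + K)) (lv K j))) ⊆ iterBlockOf (lv K j) '' (y.2 j)ᶜ) K t,
          weightAK₁₃ θ hP K₀ g₀ os kr K t u ≤ η K j ^ k K j * ∑ u ∈ classSetK₁₃ θ K₀ g₀ kr K, weightAK₁₃ θ hP K₀ g₀ os kr K t u)
    (hEB : ∀ (K : ℕ) (t : ℝ), |t| ≤ 1 → ∀ j ∈ Finset.Icc 1 (jcut K), ∀ p ∈ sepAnimalCoverFamily (SiteTouch (P := F.P (K₀ + K)) (j := lv K j)) (Nr K j) (k K j),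
      ∑ u ∈ badClassK₁₃ θ K₀ g₀ kr (fun _ u => ∀ y : SiteSeqKey F (K₀ + K), u = ⟨K, y⟩ →
          (↑p.2 : Set (Site (F.P (K₀ + K)) (lv K j))) ⊆ iterBlockOf (lv K j) '' (y.2 j)ᶜ) K t,
          weightBK₁₃ θ hP K₀ g₀ os kr K t u ≤ η K j ^ k K j * ∑ u ∈ classSetK₁₃ θ K₀ g₀ kr K, weightBK₁₃ θ hP K₀ g₀ os kr K t u)
    (hlt : ∀ K, ∑ j ∈ Finset.Icc 1 (jcut K),
      Fintype.card (Site (F.P (K₀ + K)) (lv K j)) * ((m K j : ℝ) * 3 ^ (F.P (K₀ + K)).d * m K j) ^ (2 * (k K j - 1)) * η K j ^ k K j < 1)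
    (hsum : Summable fun K => ∑ j ∈ Finset.Icc 1 (jcut K),
      Fintype.card (Site (F.P (K₀ + K)) (lv K j)) * ((m K j : ℝ) * 3 ^ (F.P (K₀ + K)).d * m K j) ^ (2 * (k K j - 1)) * η K j ^ k K j) :
    RelWeightBound 1 (classSetK₁₃ θ K₀ g₀ kr) (weightAK₁₃ θ hP K₀ g₀ os kr) (weightBK₁₃ θ hP K₀ g₀ os kr)
      (badClassK₁₃ θ K₀ g₀ kr (badKeyReadingOfBigComponent₁₃ N K₀ jcut (bigDialOfCard₁₃ K₀ (fun K j => m K j * k K j * (F.L ^ 4) ^ lv K j)) F θ hP g₀ os))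
      (fun K => ∑ j ∈ Finset.Icc 1 (jcut K),
        Fintype.card (Site (F.P (K₀ + K)) (lv K j)) * ((m K j : ℝ) * 3 ^ (F.P (K₀ + K)).d * m K j) ^ (2 * (k K j - 1)) * η K j ^ k K j) := by
  have ha0 : ∀ K j, 0 ≤ Fintype.card (Site (F.P (K₀ + K)) (lv K j)) * ((m K j : ℝ) * 3 ^ (F.P (K₀ + K)).d * m K j) ^ (2 * (k K j - 1)) * η K j ^ k K j :=
    fun K j => mul_nonneg (mul_nonneg (Nat.cast_nonneg _) (pow_nonneg (by positivity) _)) (pow_nonneg (hη K j) _)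
  have hW := relWeightBound_bigComponent_of_levelLetters θ hP K₀ g₀ os kr jcut (bigDialOfCard₁₃ K₀ (fun K j => m K j * k K j * (F.L ^ 4) ^ lv K j)) hkr
    (a := fun K j => Fintype.card (Site (F.P (K₀ + K)) (lv K j)) * ((m K j : ℝ) * 3 ^ (F.P (K₀ + K)).d * m K j) ^ (2 * (k K j - 1)) * η K j ^ k K j)
    (b := fun K j => Fintype.card (Site (F.P (K₀ + K)) (lv K j)) * ((m K j : ℝ) * 3 ^ (F.P (K₀ + K)).d * m K j) ^ (2 * (k K j - 1)) * η K j ^ k K j)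
    ha0 (fun K t ht j hj => levelLetter_of_sepBlockLetters_left θ hP K₀ g₀ os kr m k lv Nr hkr hη K (hlv K j) (hk K j) (hrefl K j) (hsymm K j) (hm K j) (hEA K t ht j hj))
    (fun K t ht j hj => levelLetter_of_sepBlockLetters_right θ hP K₀ g₀ os kr m k lv Nr hkr hη K (hlv K j) (hk K j) (hrefl K j) (hsymm K j) (hm K j) (hEB K t ht j hj))
    (fun K => by simpa only [max_self] using hlt K) (by simpa only [max_self] using hsum)
  simpa only [max_self] using hW

/-- ★★★ **THE N20 FACE AT THE SKELETON DIAL FROM SEPARATED BLOCK LETTERS ALONE — THE NUMERICAL HALF DISCHARGED**: separated block letters `0 ≤ η K j ≤ η₀ ≤ 1` with the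
per-level smallness `2·(m K j·3^4·m K j)²·η K j ≤ 1` in both runs, under the skeleton threshold schedule `k K j ≥ ⌈log₂ |Site_{lv K j}|⌉ + K + j + 3`, give `RelWeightBound`
at the coarse carriers with the displayed geometric weight `W K := η₀ · 2^{−(K+1)}` (`< 1`, `Σ_K = η₀`). [bookkeeping] -/
theorem relWeightBound_card_of_sepBlockLetters_geometric (hkr : ∀ (K : ℕ) (x : Σ K, SiteSeqKey F (K₀ + K)), x ∈ classSet₁₃ θ K₀ g₀ K → (kr K x).1 = K)
    {η : ℕ → ℕ → ℝ} {η₀ : ℝ} (hη0 : ∀ K j, 0 ≤ η K j) (hη1 : ∀ K j, η K j ≤ η₀) (hη₀ : η₀ ≤ 1)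
    (hD : ∀ K j, 2 * ((m K j : ℝ) * 3 ^ 4 * m K j) ^ 2 * η K j ≤ 1)
    (hks : ∀ K j, Nat.clog 2 (Fintype.card (Site (F.P (K₀ + K)) (lv K j))) + K + j + 3 ≤ k K j) (hlv : ∀ K j, lv K j ≤ F.m + (K₀ + K))
    (hrefl : ∀ K j a, Nr K j a a) (hsymm : ∀ K j a b, Nr K j a b → Nr K j b a)
    (hm : ∀ K j b, ∃ s : Finset (Site (F.P (K₀ + K)) (lv K j)), s.card ≤ m K j ∧ ∀ c, Nr K j c b → c ∈ s)
    (hEA : ∀ (K : ℕ) (t : ℝ), |t| ≤ 1 → ∀ j ∈ Finset.Icc 1 (jcut K), ∀ p ∈ sepAnimalCoverFamily (SiteTouch (P := F.P (K₀ + K)) (j := lv K j)) (Nr K j) (k K j),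
      ∑ u ∈ badClassK₁₃ θ K₀ g₀ kr (fun _ u => ∀ y : SiteSeqKey F (K₀ + K), u = ⟨K, y⟩ →
          (↑p.2 : Set (Site (F.P (K₀ + K)) (lv K j))) ⊆ iterBlockOf (lv K j) '' (y.2 j)ᶜ) K t,
          weightAK₁₃ θ hP K₀ g₀ os kr K t u ≤ η K j ^ k K j * ∑ u ∈ classSetK₁₃ θ K₀ g₀ kr K, weightAK₁₃ θ hP K₀ g₀ os kr K t u)
    (hEB : ∀ (K : ℕ) (t : ℝ), |t| ≤ 1 → ∀ j ∈ Finset.Icc 1 (jcut K), ∀ p ∈ sepAnimalCoverFamily (SiteTouch (P := F.P (K₀ + K)) (j := lv K j)) (Nr K j) (k K j),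
      ∑ u ∈ badClassK₁₃ θ K₀ g₀ kr (fun _ u => ∀ y : SiteSeqKey F (K₀ + K), u = ⟨K, y⟩ →
          (↑p.2 : Set (Site (F.P (K₀ + K)) (lv K j))) ⊆ iterBlockOf (lv K j) '' (y.2 j)ᶜ) K t,
          weightBK₁₃ θ hP K₀ g₀ os kr K t u ≤ η K j ^ k K j * ∑ u ∈ classSetK₁₃ θ K₀ g₀ kr K, weightBK₁₃ θ hP K₀ g₀ os kr K t u) :
    RelWeightBound 1 (classSetK₁₃ θ K₀ g₀ kr) (weightAK₁₃ θ hP K₀ g₀ os kr) (weightBK₁₃ θ hP K₀ g₀ os kr)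
      (badClassK₁₃ θ K₀ g₀ kr (badKeyReadingOfBigComponent₁₃ N K₀ jcut (bigDialOfCard₁₃ K₀ (fun K j => m K j * k K j * (F.L ^ 4) ^ lv K j)) F θ hP g₀ os))
      (fun K => η₀ * (1 / 2) ^ (K + 1)) := by
  have hη₀0 : 0 ≤ η₀ := (hη0 0 0).trans (hη1 0 0)
  have hk1 : ∀ K j, 1 ≤ k K j := fun K j => le_trans (by omega) (hks K j)
  have hS : ∀ K, ∑ j ∈ Finset.Icc 1 (jcut K),
      Fintype.card (Site (F.P (K₀ + K)) (lv K j)) * ((m K j : ℝ) * 3 ^ (F.P (K₀ + K)).d * m K j) ^ (2 * (k K j - 1)) * η K j ^ k K j ≤ η₀ * (1 / 2) ^ (K + 1) := by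
    intro K
    have h := levelSum_le_of_schedule_base jcut (fun K j => Fintype.card (Site (F.P (K₀ + K)) (lv K j))) k
      (fun K j => (m K j : ℝ) * 3 ^ 4 * m K j) η (fun K j => by positivity) hη0 hη1 hD hks K
    simpa only [T4Family.P_d] using h
  have ha0 : ∀ K j, 0 ≤ Fintype.card (Site (F.P (K₀ + K)) (lv K j)) * ((m K j : ℝ) * 3 ^ (F.P (K₀ + K)).d * m K j) ^ (2 * (k K j - 1)) * η K j ^ k K j :=
    fun K j => mul_nonneg (mul_nonneg (Nat.cast_nonneg _) (pow_nonneg (by positivity) _)) (pow_nonneg (hη0 K j) _)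
  have hlt1 : ∀ K, η₀ * (1 / 2 : ℝ) ^ (K + 1) < 1 := fun K =>
    calc η₀ * (1 / 2 : ℝ) ^ (K + 1) ≤ 1 * (1 / 2 : ℝ) ^ (0 + 1) :=
          mul_le_mul hη₀ (pow_le_pow_of_le_one (by norm_num) (by norm_num) (by omega)) (pow_nonneg (by norm_num) _) zero_le_one
      _ < 1 := by norm_num
  have hsumW : Summable fun K => η₀ * (1 / 2 : ℝ) ^ (K + 1) :=
    ((summable_geometric_of_lt_one (by norm_num) (by norm_num : (1 / 2 : ℝ) < 1)).mul_left η₀).comp_injective (add_left_injective 1)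
      |>.congr (fun K => by simp [Function.comp, pow_succ])
  have hW := relWeightBound_card_of_sepBlockLetters θ hP K₀ g₀ os kr jcut m k lv Nr hkr hη0 hk1 hlv hrefl hsymm hm hEA hEB
    (fun K => (hS K).trans_lt (hlt1 K)) (Summable.of_nonneg_of_le (fun K => Finset.sum_nonneg fun j _ => ha0 K j) hS hsumW)
  exact
  { bad_subset := hW.bad_subset
    nonneg := fun K => mul_nonneg hη₀0 (pow_nonneg (by norm_num) _)
    lt_one := hlt1
    summable := hsumW
    bad_left := fun K t ht => (hW.bad_left K t ht).trans (mul_le_mul_of_nonneg_right (hS K)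
      (Finset.sum_nonneg fun u _ => weightAK₁₃_nonneg θ hP K₀ g₀ os kr (fun x _ => weightA₁₃_nonneg F θ hP K₀ g₀ os K t x) u))
    bad_right := fun K t ht => (hW.bad_right K t ht).trans (mul_le_mul_of_nonneg_right (hS K)
      (Finset.sum_nonneg fun u _ => weightBK₁₃_nonneg θ hP K₀ g₀ os kr (fun x _ => weightB₁₃_nonneg F θ hP K₀ g₀ os K t x) u)) }

end Assembly

end YMDAG.UVSplit

end
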